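import Summits.AtomisticToContinuum.Crystallization.Theorems.ExcessDecayLiouvilleDirichlet
import Summits.AtomisticToContinuum.Crystallization.Theorems.ExcessDecayLiouvilleEnergyIdentity

/-!
# Route `ExcessDecayLiouville`: solvability of the Dirichlet problem for the force-constant operator

Harmonic-replacement step of the excess-decay argument for item `ExcessDecay`
(stmt-AtomisticToContinuum-9334).  For an admissible datum, the coercivity schema `hκ` (`κ > 0`,
`coercive_of_phononStability`) and a FINITE set `F` of sites, the linear map
`w ↦ ((L w)(p))_{p ∈ F}` on displacements supported in `F`,
`(L w)(p) = Σ'_{q ≠ p} K(p−q)(w p − w q)`, is injective (energy identity + Poincaré: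
`κ‖w‖₂² ≤ C_R Σ'⟪Lw, w⟫ = 0`) and therefore surjective (finite dimension):

* `opRow_add_field`, `opRow_smul_field` : linearity of the operator row in the (finitely supported) field;
* `eq_zero_of_opRow_eq_zero` : a displacement supported in `F` whose operator rows vanish on `F` is zero;
* `exists_dirichlet_solution` : for every target `b` there is `w` supported in `F` with `(L w)(p) = b p` on `F`;
* `exists_dirichlet_correction` : for a finitely supported `v` and a target `b` there is `w` supported in `F`
  with `(L (v + w))(p) = b p` for all `p ∈ F` (the "harmonic replacement" `h = v + w` of `v` in `F`).

All `[folklore]`; helper lemmas, nothing here closes an item.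
-/

noncomputable section

namespace Summit.AtomisticToContinuum.Crystallization.Theorems.ExcessDecayLiouville

open scoped BigOperators Topology InnerProductSpace RealInnerProductSpace Classical
open Literature.MathematicalPhysics.StatisticalMechanics
open Summit.AtomisticToContinuum.Crystallization.Theorems.PhononStabilityNegative

-- Local notation: the force-constant map `K(e)w = h(|e|²)w + 2⟪e,w⟫h′(|e|²)e`.
local notation3 "𝕂[" e "] " w:max =>
  (-((‖e‖ ^ 2)⁻¹) ^ 7 + ((‖e‖ ^ 2)⁻¹) ^ 4) • w + (2 * ⟪e, w⟫ * (7 * ((‖e‖ ^ 2)⁻¹) ^ 8 - 4 * ((‖e‖ ^ 2)⁻¹) ^ 5)) • e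

section

variable {t : Fin 2 → (EuclideanSpace ℝ (Fin 3))} {A : (EuclideanSpace ℝ (Fin 3)) →L[ℝ] (EuclideanSpace ℝ (Fin 3))}

-- Local notation: the operator row `(L v)(p) = Σ'_{q ≠ p} K(p − q)(v p − v q)` at a site `p`.
set_option quotPrecheck false in
local notation "𝕃[" t ", " A "] " v:max " @ " p:max =>
  tsum (fun q : Sites₀ t A => (if ((p : Sites₀ t A) : EuclideanSpace ℝ (Fin 3)) ≠ q then
    𝕂[((p : Sites₀ t A) : EuclideanSpace ℝ (Fin 3)) - q] (v ((p : Sites₀ t A) : EuclideanSpace ℝ (Fin 3)) - v q) else 0))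

/-- `K(e)` is additive in the displacement. [folklore] -/
theorem forceConst_add_right (e a b : EuclideanSpace ℝ (Fin 3)) :
    𝕂[e] (a + b) = 𝕂[e] a + 𝕂[e] b := by
  rw [inner_add_right]
  module

/-- `K(e)` commutes with scalars. [folklore] -/
theorem forceConst_smul_right (e a : EuclideanSpace ℝ (Fin 3)) (r : ℝ) :
    𝕂[e] (r • a) = r • 𝕂[e] a := by
  rw [inner_smul_right]
  module

/-- **Additivity of the operator row** in the field, for finitely supported fields. [folklore] -/
theorem opRow_add_field (hA : Adm₀ A) (hI : Inner₀ t A)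
    {v₁ v₂ : (EuclideanSpace ℝ (Fin 3)) → (EuclideanSpace ℝ (Fin 3))}
    (hv₁ : (Function.support v₁).Finite) (hv₂ : (Function.support v₂).Finite) (p : Sites₀ t A) :
    𝕃[t, A] (fun x => v₁ x + v₂ x) @ p = 𝕃[t, A] v₁ @ p + 𝕃[t, A] v₂ @ p := by
  rw [← (summable_opRow hA hI hv₁ p).tsum_add (summable_opRow hA hI hv₂ p)]
  refine tsum_congr fun q => ?_
  by_cases hpq : (p : EuclideanSpace ℝ (Fin 3)) = q
  · simp [hpq]
  · rw [if_pos hpq, if_pos hpq, if_pos hpq, ← forceConst_add_right]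
    have : v₁ p + v₂ p - (v₁ q + v₂ q) = (v₁ p - v₁ q) + (v₂ p - v₂ q) := by abel
    simp only [this]

/-- **Homogeneity of the operator row** in the field. [folklore] -/
theorem opRow_smul_field {v : (EuclideanSpace ℝ (Fin 3)) → (EuclideanSpace ℝ (Fin 3))} (r : ℝ) (p : Sites₀ t A) :
    𝕃[t, A] (fun x => r • v x) @ p = r • 𝕃[t, A] v @ p := by
  rw [← tsum_const_smul'' r]
  refine tsum_congr fun q => ?_
  by_cases hpq : (p : EuclideanSpace ℝ (Fin 3)) = q
  · simp [hpq]
  · rw [if_pos hpq, if_pos hpq, ← smul_sub, forceConst_smul_right]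

/-- **Uniqueness for the Dirichlet problem.**  A displacement supported in a finite set `F` of sites whose
operator rows vanish at every site of `F` is identically zero: the work `Σ'⟪Lw, w⟫` vanishes termwise, so
`κ‖w‖₂² ≤ C_R · 0` by `mul_tsum_norm_sq_le_work`. [folklore] -/
theorem eq_zero_of_opRow_eq_zero (hA : Adm₀ A) (hI : Inner₀ t A) {κ : ℝ} (hκ0 : 0 < κ)
    (hκ : ∀ v : (EuclideanSpace ℝ (Fin 3)) → (EuclideanSpace ℝ (Fin 3)), (Function.support v).Finite → Function.support v ⊆ Sites₀ t A →
      κ * nnForm t A v ≤ ∑' p : Sites₀ t A, ⟪𝕃[t, A] v @ p, v p⟫)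
    {F : Finset (EuclideanSpace ℝ (Fin 3))} (hF : ∀ x ∈ F, x ∈ Sites₀ t A)
    {w : (EuclideanSpace ℝ (Fin 3)) → (EuclideanSpace ℝ (Fin 3))} (hwF : Function.support w ⊆ F)
    (hrow : ∀ p : Sites₀ t A, (p : EuclideanSpace ℝ (Fin 3)) ∈ F → 𝕃[t, A] w @ p = 0) :
    w = 0 := by
  have hw : (Function.support w).Finite := F.finite_toSet.subset hwF
  have hwS : Function.support w ⊆ Sites₀ t A := fun x hx => hF x (hwF hx)
  -- a ball containing `F`
  obtain ⟨R, hR⟩ := (F.finite_toSet.isBounded).subset_closedBall (0 : EuclideanSpace ℝ (Fin 3))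
  have hwR : Function.support w ⊆ Metric.closedBall 0 (max R 0) :=
    fun x hx => Metric.closedBall_subset_closedBall (le_max_left _ _) (hR (hwF hx))
  have hwork : ∑' p : Sites₀ t A, ⟪𝕃[t, A] w @ p, w p⟫ = 0 := by
    refine (tsum_congr fun p => ?_).trans tsum_zero
    by_cases hp : (p : EuclideanSpace ℝ (Fin 3)) ∈ F
    · rw [hrow p hp, inner_zero_left]
    · have : w p = 0 := by
        by_contra h
        exact hp (hwF h)
      rw [this, inner_zero_right]
  have h1 := mul_tsum_norm_sq_le_work hA hI hκ0.le hκ hw hwS (le_max_right R 0) hwR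
  rw [hwork, mul_zero] at h1
  have hsum : Summable fun p : Sites₀ t A => ‖w p‖ ^ 2 := by
    refine summable_of_ne_finset_zero (s := (finite_support_sites (t := t) (A := A) hw).toFinset) ?_
    intro p hp
    have : w p = 0 := by
      by_contra h
      exact hp ((Set.Finite.mem_toFinset _).2 h)
    rw [this, norm_zero, zero_pow two_ne_zero]
  set T := (finite_support_sites (t := t) (A := A) hw).toFinset with hT
  have hTm : ∀ p : Sites₀ t A, p ∉ T → w p = 0 := by
    intro p hp
    by_contra h'
    exact hp ((Set.Finite.mem_toFinset _).2 h')
  have hfin : ∑' p : Sites₀ t A, ‖w p‖ ^ 2 = ∑ p ∈ T, ‖w p‖ ^ 2 :=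
    tsum_eq_sum (s := T) (fun p hp => by rw [hTm p hp, norm_zero, zero_pow two_ne_zero])
  have hnn : 0 ≤ ∑ p ∈ T, ‖w p‖ ^ 2 := Finset.sum_nonneg fun p _ => sq_nonneg _
  have h0 : ∑ p ∈ T, ‖w p‖ ^ 2 = 0 := by
    rw [hfin] at h1
    exact le_antisymm (by nlinarith) hnn
  rw [Finset.sum_eq_zero_iff_of_nonneg (fun p _ => sq_nonneg _)] at h0
  funext x
  by_contra hx
  have hxS : x ∈ Sites₀ t A := hwS hx
  have hxT : (⟨x, hxS⟩ : Sites₀ t A) ∈ T := (Set.Finite.mem_toFinset _).2 hx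
  have := h0 _ hxT
  rw [sq_eq_zero_iff, norm_eq_zero] at this
  exact hx this

/-- **Solvability of the Dirichlet problem.**  For a finite set `F` of sites and any target `b`, there is a
displacement `w` supported in `F` with `(L w)(p) = b p` at every site `p ∈ F`: the linear map
`w ↦ ((L w)(p))_{p ∈ F}` on `F → ℝ³` is injective by `eq_zero_of_opRow_eq_zero`, hence surjective
(finite dimension). [folklore] -/
theorem exists_dirichlet_solution (hA : Adm₀ A) (hI : Inner₀ t A) {κ : ℝ} (hκ0 : 0 < κ)
    (hκ : ∀ v : (EuclideanSpace ℝ (Fin 3)) → (EuclideanSpace ℝ (Fin 3)), (Function.support v).Finite → Function.support v ⊆ Sites₀ t A →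
      κ * nnForm t A v ≤ ∑' p : Sites₀ t A, ⟪𝕃[t, A] v @ p, v p⟫)
    {F : Finset (EuclideanSpace ℝ (Fin 3))} (hF : ∀ x ∈ F, x ∈ Sites₀ t A)
    (b : (EuclideanSpace ℝ (Fin 3)) → (EuclideanSpace ℝ (Fin 3))) :
    ∃ w : (EuclideanSpace ℝ (Fin 3)) → (EuclideanSpace ℝ (Fin 3)), Function.support w ⊆ F ∧
      ∀ p : Sites₀ t A, (p : EuclideanSpace ℝ (Fin 3)) ∈ F → 𝕃[t, A] w @ p = b p := by
  classical
  -- extension by zero from `F` to a field on `ℝ³`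
  set ext : (F → (EuclideanSpace ℝ (Fin 3))) →
      (EuclideanSpace ℝ (Fin 3)) → (EuclideanSpace ℝ (Fin 3)) :=
    fun w x => if hx : x ∈ F then w ⟨x, hx⟩ else 0 with hext
  have ext_apply : ∀ w (x : F), ext w x = w x := by
    intro w x
    simp only [hext, dif_pos x.2, Subtype.coe_eta]
  have ext_supp : ∀ w, Function.support (ext w) ⊆ F := by
    intro w x hx
    by_contra h
    have h' : x ∉ F := fun h'' => h (Finset.mem_coe.2 h'')
    exact hx (by simp only [hext, dif_neg h'])
  have ext_fin : ∀ w, (Function.support (ext w)).Finite := fun w => F.finite_toSet.subset (ext_supp w)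
  have ext_add : ∀ w₁ w₂, ext (w₁ + w₂) = fun x => ext w₁ x + ext w₂ x := by
    intro w₁ w₂; funext x
    by_cases hx : x ∈ F
    · simp only [hext, dif_pos hx, Pi.add_apply]
    · simp only [hext, dif_neg hx, add_zero]
  have ext_smul : ∀ (r : ℝ) w, ext (r • w) = fun x => r • ext w x := by
    intro r w; funext x
    by_cases hx : x ∈ F
    · simp only [hext, dif_pos hx, Pi.smul_apply]
    · simp only [hext, dif_neg hx, smul_zero]
  -- the linear map `w ↦ ((L (ext w))(p))_{p ∈ F}`
  let Φ : (F → (EuclideanSpace ℝ (Fin 3))) →ₗ[ℝ]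
      (F → (EuclideanSpace ℝ (Fin 3))) :=
    { toFun := fun w p => 𝕃[t, A] (ext w) @ (⟨(p : EuclideanSpace ℝ (Fin 3)), hF _ p.2⟩ : Sites₀ t A)
      map_add' := fun w₁ w₂ => by
        funext p
        simp only [Pi.add_apply]
        rw [ext_add]
        exact opRow_add_field hA hI (ext_fin w₁) (ext_fin w₂) ⟨p, hF _ p.2⟩
      map_smul' := fun r w => by
        funext p
        simp only [Pi.smul_apply, RingHom.id_apply]
        rw [ext_smul]
        exact opRow_smul_field r ⟨p, hF _ p.2⟩ }
  have hΦ : ∀ w (p : F),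
      Φ w p = 𝕃[t, A] (ext w) @ (⟨(p : EuclideanSpace ℝ (Fin 3)), hF _ p.2⟩ : Sites₀ t A) := fun w p => rfl
  have hinj : Function.Injective Φ := by
    intro w₁ w₂ h
    have h0 : Φ (w₁ - w₂) = 0 := by rw [map_sub, h, sub_self]
    have hz := eq_zero_of_opRow_eq_zero hA hI hκ0 hκ hF (ext_supp (w₁ - w₂)) (fun p hp => by
      have := congrFun h0 ⟨p, hp⟩
      rw [hΦ] at this
      exact this)
    rw [← sub_eq_zero]
    funext p
    have := congrFun hz (p : EuclideanSpace ℝ (Fin 3))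
    rwa [ext_apply] at this
  obtain ⟨w, hw⟩ := LinearMap.surjective_of_injective hinj (fun p => b p)
  refine ⟨ext w, ext_supp w, fun p hp => ?_⟩
  have := congrFun hw ⟨p, hp⟩
  rw [hΦ] at this
  exact this

/-- **Harmonic replacement.**  For a finitely supported `v`, a finite set `F` of sites and a target `b`,
there is a correction `w` supported in `F` such that `h = v + w` satisfies `(L h)(p) = b p` for all
`p ∈ F` (and `h = v` off `F`). [folklore] -/
theorem exists_dirichlet_correction (hA : Adm₀ A) (hI : Inner₀ t A) {κ : ℝ} (hκ0 : 0 < κ)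
    (hκ : ∀ v : (EuclideanSpace ℝ (Fin 3)) → (EuclideanSpace ℝ (Fin 3)), (Function.support v).Finite → Function.support v ⊆ Sites₀ t A →
      κ * nnForm t A v ≤ ∑' p : Sites₀ t A, ⟪𝕃[t, A] v @ p, v p⟫)
    {F : Finset (EuclideanSpace ℝ (Fin 3))} (hF : ∀ x ∈ F, x ∈ Sites₀ t A)
    {v : (EuclideanSpace ℝ (Fin 3)) → (EuclideanSpace ℝ (Fin 3))} (hv : (Function.support v).Finite)
    (b : (EuclideanSpace ℝ (Fin 3)) → (EuclideanSpace ℝ (Fin 3))) :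
    ∃ w : (EuclideanSpace ℝ (Fin 3)) → (EuclideanSpace ℝ (Fin 3)), Function.support w ⊆ F ∧
      ∀ p : Sites₀ t A, (p : EuclideanSpace ℝ (Fin 3)) ∈ F → 𝕃[t, A] (fun x => v x + w x) @ p = b p := by
  classical
  obtain ⟨w, hwF, hw⟩ := exists_dirichlet_solution hA hI hκ0 hκ hF
    (fun x => b x - (if hx : x ∈ Sites₀ t A then 𝕃[t, A] v @ (⟨x, hx⟩ : Sites₀ t A) else 0))
  have hwfin : (Function.support w).Finite := F.finite_toSet.subset hwF
  refine ⟨w, hwF, fun p hp => ?_⟩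
  rw [opRow_add_field hA hI hv hwfin p, hw p hp, dif_pos p.2]
  abel

end

end Summit.AtomisticToContinuum.Crystallization.Theorems.ExcessDecayLiouville

end
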